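import Summits.QuantumFields.YangMills.Theorems.SwapVirialDeficitZeroModeSigmaFourSmallBallLinear
import HarnessLib

/-!
# Exact zero-mode rung Z5 — the σ-TWISTED FOUR-LEADER small ball, IX: the EXACT relations bound the ratios on the rescaled event
# (deterministic side of the RATE; complements part VIII (limit event); free-hands support of ⟨stmt-QuantumFields-24197⟩, division of labour with w2 g56)

Part VIII bounded the three ratios `a = ‖x_⊥‖/‖x̄‖`, `b = ‖y_⊥‖/‖ȳ‖`, `c = ‖ζ‖/|z₀|` on the LIMIT event `limSigma r A` by `2r/|αβ|` (axial unit hub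
`A = α + βi`).  Here the same is done on the RESCALED event `rescaledSigmaR r s A` itself, for scales `s` with `r·s ≤ |αβ|`, from three EXACT identities
of the relation maps at scale `s` (unit hub, `X = X(s)`, `Z = Z(s)`):
* §43 ★ `Mrel_three_eq_mul`: `M₃(s) = X·A·(Z − 1)`, so `‖M₃(s)‖ = ‖Z(s) − 1‖` ⟹ `z₀ > 0` (`re_pos_of_mem_rescaledSigmaR`, `rs < 1`) and `c ≤ 2r`
  (`rs ≤ 1/2`); ★ `axial_comm_Xp`: `B·X(s) − X(s)·B = (s/‖D_s x‖)·(B·x_⊥ − x_⊥·B)` for axial `B`, so `‖M₅(s)‖ = 2|β|·s‖y_⊥‖/‖D_s y‖` ⟹ `|β|·b ≤ r`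
  (`rs ≤ |β|`); ★ `Mrel_four_identity`: `A²X − XA² = A·M₄(s) + X·A·(Z − 1)·A` ⟹ `|αβ|·a ≤ r` (`rs ≤ |αβ|`);
* ★★ `ratios_le_of_mem_rescaledSigmaR` / `sum_ratios_le_of_mem_rescaledSigmaR`: for `r·s ≤ |αβ|` (note `|αβ| ≤ 1/2`), on `rescaledSigmaR r s A`
  (`x̄, ȳ ≠ 0`): `z₀ > 0` and `a + b + c ≤ 3r/|αβ|` — together with part VIII the region `{a + b + c > 3r/|αβ|}` meets NEITHER event, so the
  measure side needs no Markov step there (only the hub caps `|αβ| → 0` and the scales `s > |αβ|/r`).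
HONEST LABEL: deterministic finite-dimensional algebra (plan-level zero-mode rung of the DRAFT line «sharp-sigma»); no rate is proved here; NOT ⟨24197⟩;
own crux ⟨22884⟩ OPEN (blocked-on ⟨19935⟩); the Yang–Mills mass gap is NOT proved; no summit is proved by a line.
Width seat ym-line-sfw-p2-w3 g63 (cell ym-idea-1, free hands), `--supports stmt-QuantumFields-24197`.  THEOREMS ONLY, standard axioms, 0 `sorry`.
References: [cite: GonzalezarroyoAltes1988]; [cite: Vanbaal2001]; [cite: Luscher1983, §2]; [folklore].
-/

set_option autoImplicit false

noncomputable section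

open Quaternion Set
open scoped Quaternion RealInnerProductSpace
open Literature.MathematicalPhysics.QuantumLattice
open Literature.Analysis.Calculus (radialUnit radialUnit_def norm_radialUnit tangentialProj tangentialProj_apply tangentialProj_eq_self)
open Summit.QuantumFields.YangMills.Theorems.SwapTwistDeficit.ToronLog
open Summit.QuantumFields.YangMills.Theorems.SwapVirialDeficit.ZeroModeGroup
open Summit.QuantumFields.YangMills.Theorems.ToronValleyVolume.NearlyCommutingCeiling (sq_norm_im_eq)

namespace Summit.QuantumFields.YangMills.Theorems.SwapVirialDeficit.ZeroModeSigma

/-! ## §43 Exact identities of the relation maps at scale `s`, and the ratio bounds on the rescaled event -/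

/-- `‖x̄‖ ≤ ‖D_s x‖` (orthogonality). [folklore] -/
theorem norm_axPart_le_norm_dilate (s : ℝ) (x : ℍ) : ‖axPart x‖ ≤ ‖dilate s x‖ := by
  have h := norm_dilate_sq s x
  have h2 : ‖axPart x‖ ^ 2 ≤ ‖dilate s x‖ ^ 2 := by rw [h]; nlinarith [sq_nonneg s, sq_nonneg ‖trPart x‖, mul_nonneg (sq_nonneg s) (sq_nonneg ‖trPart x‖)]
  exact (pow_le_pow_iff_left₀ (norm_nonneg _) (norm_nonneg _) two_ne_zero).1 h2

/-- `‖D_s x‖ ≤ ‖x̄‖ + s‖x_⊥‖` for `0 ≤ s`. [folklore] -/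
theorem norm_dilate_le {s : ℝ} (hs : 0 ≤ s) (x : ℍ) : ‖dilate s x‖ ≤ ‖axPart x‖ + s * ‖trPart x‖ := by
  rw [dilate_eq_axPart_add]
  calc ‖axPart x + s • trPart x‖ ≤ ‖axPart x‖ + ‖s • trPart x‖ := norm_add_le _ _
    _ = ‖axPart x‖ + s * ‖trPart x‖ := by rw [norm_smul, Real.norm_eq_abs, abs_of_nonneg hs]

/-- `‖D³_s z‖ ≤ |z₀| + s‖ζ‖` for `0 ≤ s`. [folklore] -/
theorem norm_dilateIm_le {s : ℝ} (hs : 0 ≤ s) (z : ℍ) : ‖dilateIm s z‖ ≤ |z.re| + s * ‖z.im‖ := by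
  rw [dilateIm_eq_re_add]
  calc ‖(z.re : ℍ) + s • z.im‖ ≤ ‖(z.re : ℍ)‖ + ‖s • z.im‖ := norm_add_le _ _
    _ = |z.re| + s * ‖z.im‖ := by rw [Quaternion.norm_coe, Real.norm_eq_abs, norm_smul, Real.norm_eq_abs, abs_of_nonneg hs]

/-- `|z₀| ≤ ‖D³_s z‖`. [folklore] -/
theorem abs_re_le_norm_dilateIm (s : ℝ) (z : ℍ) : |z.re| ≤ ‖dilateIm s z‖ := by
  have h := abs_re_le_norm (dilateIm s z)
  have e : (dilateIm s z).re = z.re := by rw [dilateIm_eq_re_add]; simp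
  rwa [e] at h

/-- `‖X(s)‖ = 1` when `x̄ ≠ 0`. [folklore] -/
theorem norm_Xp {x : ℍ} (hx : axPart x ≠ 0) (s : ℝ) : ‖Xp x s‖ = 1 := by
  rw [Xp_eq]
  apply norm_radialUnit
  intro h0
  have h := norm_axPart_le_norm_dilate s x
  rw [h0, norm_zero] at h
  exact hx (norm_eq_zero.1 (le_antisymm h (norm_nonneg _)))

/-- ★ **`M₃(s) = X(s)·A·(Z(s) − 1)`** for a unit hub (`A·Ā = 1`). [folklore] -/
theorem Mrel_three_eq_mul {A : ℍ} (hA : ‖A‖ = 1) (x y z : ℍ) (s : ℝ) : Mrel A x y z 3 s = Xp x s * A * (Zp z s - 1) := by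
  have hAA : A * star A = 1 := by
    rw [Quaternion.self_mul_star, Quaternion.normSq_eq_norm_mul_self, hA, mul_one, Quaternion.coe_one]
  show A * (star A * Xp x s * A * Zp z s) - Xp x s * A = _
  rw [mul_sub, mul_one]
  simp only [← mul_assoc]
  rw [hAA, one_mul]

/-- ★ `‖M₃(s)‖ = ‖Z(s) − 1‖` (`x̄ ≠ 0`, unit hub). [folklore] -/
theorem norm_Mrel_three_eq {A : ℍ} (hA : ‖A‖ = 1) {x : ℍ} (hx : axPart x ≠ 0) (y z : ℍ) (s : ℝ) : ‖Mrel A x y z 3 s‖ = ‖Zp z s - 1‖ := by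
  rw [Mrel_three_eq_mul hA, norm_mul, norm_mul, norm_Xp hx, hA, one_mul, one_mul]

/-- `Z(s).re = z₀/‖D³_s z‖`. [folklore] -/
theorem Zp_re (z : ℍ) (s : ℝ) : (Zp z s).re = ‖dilateIm s z‖⁻¹ * z.re := by
  rw [Zp_eq, (radialUnit_components _).1]
  congr 1
  rw [dilateIm_eq_re_add]; simp

/-- `‖Z(s) − 1‖ ≥ s‖ζ‖/‖D³_s z‖` (the imaginary part of `Z(s) − 1` is that of `Z(s)`). [folklore] -/
theorem norm_Zp_sub_one_ge (z : ℍ) {s : ℝ} (hs : 0 ≤ s) : ‖dilateIm s z‖⁻¹ * (s * ‖z.im‖) ≤ ‖Zp z s - 1‖ := by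
  have him : (Zp z s - 1).im = (‖dilateIm s z‖⁻¹ * s) • z.im := by
    rw [Zp_eq, radialUnit_def, Quaternion.im_sub, Quaternion.im_one, sub_zero, Quaternion.im_smul, dilateIm_eq_re_add, Quaternion.im_add,
      Quaternion.im_coe, zero_add, Quaternion.im_smul, Quaternion.im_idem, smul_smul]
  have h1 : ‖(Zp z s - 1).im‖ ≤ ‖Zp z s - 1‖ := by
    have e := sq_norm_im_eq (Zp z s - 1)
    exact (pow_le_pow_iff_left₀ (norm_nonneg _) (norm_nonneg _) two_ne_zero).1 (by rw [e]; nlinarith [sq_nonneg (Zp z s - 1).re])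
  rw [him, norm_smul, Real.norm_eq_abs, abs_of_nonneg (mul_nonneg (inv_nonneg.2 (norm_nonneg _)) hs), mul_assoc] at h1
  exact h1

/-- ★ **`z₀ > 0` on the rescaled event** as soon as `rs < 1` (`x̄ ≠ 0`, unit hub): `‖Z(s) − 1‖ ≤ rs < 1` forces `Re Z(s) > 0`. [folklore] -/
theorem re_pos_of_mem_rescaledSigmaR {r s : ℝ} {A : ℍ} (hA : ‖A‖ = 1) {w : (ℍ × ℍ) × ℍ} (hx : axPart w.1.1 ≠ 0) (hrs : r * s < 1)
    (hw : w ∈ rescaledSigmaR r s A) : 0 < w.2.re := by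
  have h3 := ((mem_rescaledSigmaR_iff r s A w).1 hw).1 3
  rw [norm_Mrel_three_eq hA hx] at h3
  have hre : |(Zp w.2 s - 1).re| < 1 := ((abs_re_le_norm _).trans h3).trans_lt hrs
  rw [Quaternion.re_sub, Quaternion.re_one, Zp_re] at hre
  have hpos : 0 < ‖dilateIm s w.2‖⁻¹ * w.2.re := by have := (abs_lt.1 hre).1; linarith
  by_contra hz
  nlinarith [mul_nonneg (inv_nonneg.2 (norm_nonneg (dilateIm s w.2))) (neg_nonneg.2 (not_lt.1 hz))]

/-- ★ **`c ≤ 2r` on the rescaled event** (`0 < s`, `rs ≤ 1/2`, `x̄ ≠ 0`, unit hub). [folklore] -/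
theorem imRatio_le_of_mem_rescaledSigmaR {r s : ℝ} {A : ℍ} (hA : ‖A‖ = 1) {w : (ℍ × ℍ) × ℍ} (hx : axPart w.1.1 ≠ 0) (hs : 0 < s)
    (hrs : r * s ≤ 1 / 2) (hw : w ∈ rescaledSigmaR r s A) : imRatio w.2 ≤ 2 * r := by
  have hz := re_pos_of_mem_rescaledSigmaR hA hx (by linarith) hw
  have h3 := ((mem_rescaledSigmaR_iff r s A w).1 hw).1 3
  rw [norm_Mrel_three_eq hA hx] at h3
  have hv : ‖dilateIm s w.2‖ ≤ |w.2.re| + s * ‖w.2.im‖ := norm_dilateIm_le hs.le w.2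
  have hv0 : 0 < ‖dilateIm s w.2‖ := lt_of_lt_of_le (abs_pos.2 hz.ne') (abs_re_le_norm_dilateIm s w.2)
  have h4 : s * ‖w.2.im‖ ≤ ‖dilateIm s w.2‖ * (r * s) := by
    have := (norm_Zp_sub_one_ge w.2 hs.le).trans h3
    rwa [inv_mul_le_iff₀ hv0] at this
  have hr : 0 ≤ r := by
    have : 0 ≤ r * s := (norm_nonneg _).trans h3
    nlinarith
  have h5 : ‖w.2.im‖ ≤ r * ‖dilateIm s w.2‖ := le_of_mul_le_mul_left (by linarith) hs
  rw [imRatio, Quaternion.norm_coe, Real.norm_eq_abs, div_le_iff₀ (abs_pos.2 hz.ne')]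
  nlinarith [mul_le_mul_of_nonneg_left hv hr, mul_le_mul_of_nonneg_right hrs (norm_nonneg w.2.im)]

/-- ★ **Axial elements almost commute with the pair-letter path**: `B·X(s) − X(s)·B = (s/‖D_s x‖)·(B·x_⊥ − x_⊥·B)` for an axial `B`. [folklore] -/
theorem axial_comm_Xp {B : ℍ} (hJ : B.imJ = 0) (hK : B.imK = 0) (x : ℍ) (s : ℝ) :
    B * Xp x s - Xp x s * B = (‖dilate s x‖⁻¹ * s) • (B * trPart x - trPart x * B) := by
  have hc : B * axPart x = axPart x * B := axial_comm hJ hK (by simp [axPart]) (by simp [axPart])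
  rw [Xp_eq, radialUnit_def, mul_smul_comm, smul_mul_assoc, ← smul_sub, dilate_eq_axPart_add, mul_add, add_mul, hc, add_sub_add_left_eq_sub,
    mul_smul_comm, smul_mul_assoc, ← smul_sub, smul_smul]

/-- ★ `‖M₅(s)‖ = (s/‖D_s y‖)·2|β|·‖y_⊥‖` for an axial hub and `0 ≤ s`. [folklore] -/
theorem norm_Mrel_five_eq {A : ℍ} (hJ : A.imJ = 0) (hK : A.imK = 0) (x y z : ℍ) {s : ℝ} (hs : 0 ≤ s) :
    ‖Mrel A x y z 5 s‖ = ‖dilate s y‖⁻¹ * s * (2 * |A.imI| * ‖trPart y‖) := by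
  show ‖A * Xp y s - Xp y s * A‖ = _
  rw [axial_comm_Xp hJ hK, norm_smul, norm_axial_comm_transversal hJ hK (by simp [trPart]) (by simp [trPart]), Real.norm_eq_abs,
    abs_of_nonneg (mul_nonneg (inv_nonneg.2 (norm_nonneg _)) hs)]

/-- ★ **`|β|·b ≤ r` on the rescaled event** (`0 < s`, `rs ≤ |β|`, `ȳ ≠ 0`, axial hub). [folklore] -/
theorem trRatio_snd_le_of_mem_rescaledSigmaR {r s : ℝ} {A : ℍ} (hJ : A.imJ = 0) (hK : A.imK = 0) {w : (ℍ × ℍ) × ℍ} (hy : axPart w.1.2 ≠ 0)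
    (hs : 0 < s) (hrs : r * s ≤ |A.imI|) (hw : w ∈ rescaledSigmaR r s A) : |A.imI| * trRatio w.1.2 ≤ r := by
  have h5 := ((mem_rescaledSigmaR_iff r s A w).1 hw).1 5
  rw [norm_Mrel_five_eq hJ hK _ _ _ hs.le, mul_assoc] at h5
  have hD0 : 0 < ‖dilate s w.1.2‖ := lt_of_lt_of_le (norm_pos_iff.2 hy) (norm_axPart_le_norm_dilate s _)
  have hD := norm_dilate_le hs.le w.1.2
  rw [inv_mul_le_iff₀ hD0] at h5
  have hr : 0 ≤ r := by
    have : 0 ≤ ‖dilate s w.1.2‖ * (r * s) := le_trans (by positivity) h5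
    nlinarith [mul_pos hD0 hs]
  have h6 : 2 * |A.imI| * ‖trPart w.1.2‖ ≤ r * ‖dilate s w.1.2‖ := le_of_mul_le_mul_left (by linarith) hs
  rw [trRatio, mul_div_assoc', div_le_iff₀ (norm_pos_iff.2 hy)]
  nlinarith [mul_le_mul_of_nonneg_left hD hr, mul_le_mul_of_nonneg_right hrs (norm_nonneg (trPart w.1.2)), abs_nonneg A.imI,
    norm_nonneg (trPart w.1.2)]

/-- ★ **`A·M₄(s) + X(s)·A·(Z(s) − 1)·A = A²·X(s) − X(s)·A²`** for a unit hub. [folklore] -/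
theorem Mrel_four_identity {A : ℍ} (hA : ‖A‖ = 1) (x y z : ℍ) (s : ℝ) :
    A * A * Xp x s - Xp x s * (A * A) = A * Mrel A x y z 4 s + Xp x s * A * (Zp z s - 1) * A := by
  have hAA : A * star A = 1 := by
    rw [Quaternion.self_mul_star, Quaternion.normSq_eq_norm_mul_self, hA, mul_one, Quaternion.coe_one]
  show _ = A * (A * Xp x s - star A * Xp x s * A * Zp z s * A) + _
  rw [mul_sub A, show A * (star A * Xp x s * A * Zp z s * A) = (A * star A) * Xp x s * A * Zp z s * A by noncomm_ring, hAA, one_mul]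
  noncomm_ring

/-- `(A²)` is axial with `(A²)_i = 2αβ`. [folklore] -/
theorem sq_axial {A : ℍ} (hJ : A.imJ = 0) (hK : A.imK = 0) : (A * A).imJ = 0 ∧ (A * A).imK = 0 ∧ (A * A).imI = 2 * (A.re * A.imI) := by
  refine ⟨by simp [hJ, hK], by simp [hJ, hK], by simp [hJ, hK]; ring⟩

/-- ★ **`|αβ|·a ≤ r` on the rescaled event** (`0 < s`, `rs ≤ |αβ|`, `x̄ ≠ 0`, axial unit hub). [folklore] -/
theorem trRatio_fst_le_of_mem_rescaledSigmaR {r s : ℝ} {A : ℍ} (hA : ‖A‖ = 1) (hJ : A.imJ = 0) (hK : A.imK = 0) {w : (ℍ × ℍ) × ℍ}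
    (hx : axPart w.1.1 ≠ 0) (hs : 0 < s) (hrs : r * s ≤ |A.re * A.imI|) (hw : w ∈ rescaledSigmaR r s A) : |A.re * A.imI| * trRatio w.1.1 ≤ r := by
  obtain ⟨hM, -⟩ := (mem_rescaledSigmaR_iff r s A w).1 hw
  have h3 := hM 3
  have h4 := hM 4
  rw [norm_Mrel_three_eq hA hx] at h3
  obtain ⟨h2J, h2K, h2I⟩ := sq_axial hJ hK
  have key : ‖A * A * Xp w.1.1 s - Xp w.1.1 s * (A * A)‖ ≤ 2 * (r * s) := by
    rw [Mrel_four_identity hA]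
    calc ‖A * Mrel A w.1.1 w.1.2 w.2 4 s + Xp w.1.1 s * A * (Zp w.2 s - 1) * A‖
        ≤ ‖A * Mrel A w.1.1 w.1.2 w.2 4 s‖ + ‖Xp w.1.1 s * A * (Zp w.2 s - 1) * A‖ := norm_add_le _ _
      _ ≤ r * s + r * s := by
          rw [norm_mul, hA, one_mul, norm_mul, norm_mul, norm_mul, norm_Xp hx, hA, one_mul, one_mul, mul_one]
          exact add_le_add h4 h3
      _ = 2 * (r * s) := by ring
  rw [axial_comm_Xp h2J h2K, norm_smul, norm_axial_comm_transversal h2J h2K (by simp [trPart]) (by simp [trPart]), h2I, Real.norm_eq_abs,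
    abs_of_nonneg (mul_nonneg (inv_nonneg.2 (norm_nonneg _)) hs.le), abs_mul (2:ℝ), abs_two, mul_assoc, inv_mul_le_iff₀
      (lt_of_lt_of_le (norm_pos_iff.2 hx) (norm_axPart_le_norm_dilate s _))] at key
  -- key : s * (2 * (2 * |αβ|) * ‖x_⊥‖) ≤ ‖D‖ * (2 (r s))
  have hD := norm_dilate_le hs.le w.1.1
  have hD0 : 0 < ‖dilate s w.1.1‖ := lt_of_lt_of_le (norm_pos_iff.2 hx) (norm_axPart_le_norm_dilate s w.1.1)
  have hr : 0 ≤ r := by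
    have : 0 ≤ ‖dilate s w.1.1‖ * (2 * (r * s)) := le_trans (by positivity) key
    nlinarith [mul_pos hD0 hs]
  have h6 : 2 * |A.re * A.imI| * ‖trPart w.1.1‖ ≤ r * ‖dilate s w.1.1‖ := le_of_mul_le_mul_left (by linarith) hs
  rw [trRatio, mul_div_assoc', div_le_iff₀ (norm_pos_iff.2 hx)]
  nlinarith [mul_le_mul_of_nonneg_left hD hr, mul_le_mul_of_nonneg_right hrs (norm_nonneg (trPart w.1.1)), abs_nonneg (A.re * A.imI),
    norm_nonneg (trPart w.1.1)]

/-- `|αβ| ≤ 1/2` and `|αβ| ≤ |β|` for an axial unit. [folklore] -/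
theorem abs_mul_le_of_axial_unit {A : ℍ} (hA : ‖A‖ = 1) (hJ : A.imJ = 0) (hK : A.imK = 0) :
    |A.re * A.imI| ≤ 1 / 2 ∧ |A.re * A.imI| ≤ |A.imI| := by
  have h1 := axial_sq_add_sq hA hJ hK
  have hα : |A.re| ≤ 1 := (sq_le_one_iff_abs_le_one _).1 (by nlinarith [sq_nonneg A.imI])
  refine ⟨abs_le.2 ⟨by nlinarith [sq_nonneg (A.re + A.imI)], by nlinarith [sq_nonneg (A.re - A.imI)]⟩, ?_⟩
  rw [abs_mul]
  exact mul_le_of_le_one_left (abs_nonneg _) hα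

/-- ★★ **THE EXACT RELATIONS BOUND THE THREE RATIOS ON THE RESCALED EVENT**: for an axial unit hub `A = α + βi`, `x̄, ȳ ≠ 0`, `0 < s` and
`r·s ≤ |αβ|`, every `w ∈ rescaledSigmaR r s A` has `z₀ > 0`, `c ≤ 2r`, `|β|·b ≤ r`, `|αβ|·a ≤ r`. [folklore] -/
theorem ratios_le_of_mem_rescaledSigmaR {r s : ℝ} {A : ℍ} (hA : ‖A‖ = 1) (hJ : A.imJ = 0) (hK : A.imK = 0) {w : (ℍ × ℍ) × ℍ}
    (hx : axPart w.1.1 ≠ 0) (hy : axPart w.1.2 ≠ 0) (hs : 0 < s) (hrs : r * s ≤ |A.re * A.imI|) (hw : w ∈ rescaledSigmaR r s A) :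
    0 < w.2.re ∧ imRatio w.2 ≤ 2 * r ∧ |A.imI| * trRatio w.1.2 ≤ r ∧ |A.re * A.imI| * trRatio w.1.1 ≤ r := by
  obtain ⟨hhalf, hβ⟩ := abs_mul_le_of_axial_unit hA hJ hK
  exact ⟨re_pos_of_mem_rescaledSigmaR hA hx (by linarith) hw, imRatio_le_of_mem_rescaledSigmaR hA hx hs (hrs.trans hhalf) hw,
    trRatio_snd_le_of_mem_rescaledSigmaR hJ hK hy hs (hrs.trans hβ) hw, trRatio_fst_le_of_mem_rescaledSigmaR hA hJ hK hx hs hrs hw⟩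

/-- ★★ **Hence `a + b + c ≤ 3r/|αβ|` on `rescaledSigmaR r s A`** for `r·s ≤ |αβ| ≠ 0` (`x̄, ȳ ≠ 0`): with ✓`sum_ratios_le_of_mem_limSigma`
(part VIII) the region `{a + b + c > 3r/|αβ|}` meets neither the rescaled nor the limit event. [folklore] -/
theorem sum_ratios_le_of_mem_rescaledSigmaR {r s : ℝ} {A : ℍ} (hA : ‖A‖ = 1) (hJ : A.imJ = 0) (hK : A.imK = 0) (hαβ : A.re * A.imI ≠ 0)
    {w : (ℍ × ℍ) × ℍ} (hx : axPart w.1.1 ≠ 0) (hy : axPart w.1.2 ≠ 0) (hs : 0 < s) (hrs : r * s ≤ |A.re * A.imI|)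
    (hw : w ∈ rescaledSigmaR r s A) : trRatio w.1.1 + trRatio w.1.2 + imRatio w.2 ≤ 3 * r / |A.re * A.imI| := by
  obtain ⟨-, hc, hb, ha⟩ := ratios_le_of_mem_rescaledSigmaR hA hJ hK hx hy hs hrs hw
  obtain ⟨hhalf, hβ⟩ := abs_mul_le_of_axial_unit hA hJ hK
  obtain ⟨ha0, hc0⟩ := ratios_nonneg w.1.1 w.2
  have hb0 := (ratios_nonneg w.1.2 w.2).1
  have hp : 0 < |A.re * A.imI| := abs_pos.2 hαβ
  have hr : 0 ≤ r := le_trans (mul_nonneg hp.le ha0) ha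
  rw [le_div_iff₀ hp]
  nlinarith [mul_le_mul_of_nonneg_right hβ hb0, mul_le_mul_of_nonneg_right hhalf hc0]


/-! ## §44 The flip trichotomy at a good hub (deterministic input of the per-hub assembly) -/

/-- ★★★ **FLIP TRICHOTOMY AT A GOOD HUB.**  Let `A = α + βi` be an axial unit hub with `αβ ≠ 0`, `0 < s` and `3rs ≤ |αβ|`, and let
`w = ((x,y),z)` with `x̄, ȳ ≠ 0` be a FLIP, `¬(w ∈ rescaledSigmaR r s A ↔ w ∈ limSigma r A)`.  Then `z₀ > 0`, the ratios obey
`a + b + c ≤ R_A := 3r/|αβ|` (parts VIII/IX), and EITHER one of the three ball conditions flips — which pins the base point in the thin layer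
`‖x̄‖² < 1 ≤ ‖x̄‖² + s²‖x_⊥‖²` (resp. `ȳ`, resp. `z₀² < 1 ≤ z₀² + s²‖ζ‖²`) — OR `w` lies in the limit shell
`limSigma (r + 8s·R_A²) A \ limSigma (r − 8s·R_A²) A` (part VII + ✓`mem_shell_of_flip`).  No Markov step is needed at good hubs. [folklore] -/
theorem flip_trichotomy {r s : ℝ} {A : ℍ} (hA : ‖A‖ = 1) (hJ : A.imJ = 0) (hK : A.imK = 0) (hαβ : A.re * A.imI ≠ 0) (hs : 0 < s)
    (hrs : 3 * r * s ≤ |A.re * A.imI|) {w : (ℍ × ℍ) × ℍ} (hx : axPart w.1.1 ≠ 0) (hy : axPart w.1.2 ≠ 0)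
    (hflip : ¬ (w ∈ rescaledSigmaR r s A ↔ w ∈ limSigma r A)) :
    0 < w.2.re ∧ trRatio w.1.1 + trRatio w.1.2 + imRatio w.2 ≤ 3 * r / |A.re * A.imI| ∧
    ((‖axPart w.1.1‖ ^ 2 < 1 ∧ 1 ≤ ‖axPart w.1.1‖ ^ 2 + s ^ 2 * ‖trPart w.1.1‖ ^ 2) ∨
     (‖axPart w.1.2‖ ^ 2 < 1 ∧ 1 ≤ ‖axPart w.1.2‖ ^ 2 + s ^ 2 * ‖trPart w.1.2‖ ^ 2) ∨
     (‖(w.2.re : ℍ)‖ ^ 2 < 1 ∧ 1 ≤ ‖(w.2.re : ℍ)‖ ^ 2 + s ^ 2 * ‖w.2.im‖ ^ 2) ∨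
     w ∈ limSigma (r + 8 * s * (3 * r / |A.re * A.imI|) ^ 2) A \ limSigma (r - 8 * s * (3 * r / |A.re * A.imI|) ^ 2) A) := by
  have hp : 0 < |A.re * A.imI| := abs_pos.2 hαβ
  have hrs1 : r * s ≤ |A.re * A.imI| := by
    rcases le_or_gt 0 r with hr | hr
    · nlinarith [mul_nonneg hr hs.le]
    · nlinarith [mul_neg_of_neg_of_pos hr hs]
  -- which side of the flip holds
  have hside : 0 < w.2.re ∧ trRatio w.1.1 + trRatio w.1.2 + imRatio w.2 ≤ 3 * r / |A.re * A.imI| := by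
    by_cases hP : w ∈ rescaledSigmaR r s A
    · exact ⟨re_pos_of_mem_rescaledSigmaR hA hx (by nlinarith [(abs_mul_le_of_axial_unit hA hJ hK).1]) hP,
        sum_ratios_le_of_mem_rescaledSigmaR hA hJ hK hαβ hx hy hs hrs1 hP⟩
    · have hQ : w ∈ limSigma r A := by
        by_contra hQ; exact hflip ⟨fun h => absurd h hP, fun h => absurd h hQ⟩
      have hc := (ratios_le_of_mem_limSigma hA hJ hK hx hQ).1
      have hr : 0 ≤ r := ((ratios_nonneg w.1.1 w.2).2).trans hc
      refine ⟨((mem_limSigma_iff r A w).1 hQ).2.2.2, (sum_ratios_le_of_mem_limSigma hA hJ hK hαβ hx hQ).trans ?_⟩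
      exact div_le_div_of_nonneg_right (by linarith) hp.le
  obtain ⟨hz, hR⟩ := hside
  refine ⟨hz, hR, ?_⟩
  -- the three ball agreements, or the shell
  by_cases hbx : ‖axPart w.1.1‖ ^ 2 + s ^ 2 * ‖trPart w.1.1‖ ^ 2 < 1 ∨ 1 ≤ ‖axPart w.1.1‖ ^ 2
  swap
  · left; rw [not_or, not_lt, not_le] at hbx; exact ⟨hbx.2, hbx.1⟩
  by_cases hby : ‖axPart w.1.2‖ ^ 2 + s ^ 2 * ‖trPart w.1.2‖ ^ 2 < 1 ∨ 1 ≤ ‖axPart w.1.2‖ ^ 2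
  swap
  · right; left; rw [not_or, not_lt, not_le] at hby; exact ⟨hby.2, hby.1⟩
  by_cases hbz : ‖(w.2.re : ℍ)‖ ^ 2 + s ^ 2 * ‖w.2.im‖ ^ 2 < 1 ∨ 1 ≤ ‖(w.2.re : ℍ)‖ ^ 2
  swap
  · right; right; left; rw [not_or, not_lt, not_le] at hbz; exact ⟨hbz.2, hbz.1⟩
  right; right; right
  have hR0 : 0 ≤ trRatio w.1.1 + trRatio w.1.2 + imRatio w.2 := by
    obtain ⟨ha0, hc0⟩ := ratios_nonneg w.1.1 w.2
    have hb0 := (ratios_nonneg w.1.2 w.2).1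
    positivity
  have hsR : s * (trRatio w.1.1 + trRatio w.1.2 + imRatio w.2) ≤ 1 := by
    calc s * (trRatio w.1.1 + trRatio w.1.2 + imRatio w.2) ≤ s * (3 * r / |A.re * A.imI|) := mul_le_mul_of_nonneg_left hR hs.le
      _ = 3 * r * s / |A.re * A.imI| := by ring
      _ ≤ 1 := by rw [div_le_one hp]; exact hrs
  have hshell := mem_shell_of_flip_taylor hA hJ hK hs hx hy hz hsR (dilate_ball_iff hbx) (dilate_ball_iff hby) (dilateIm_ball_iff hbz) hflip
  have hδ : 8 * s * (trRatio w.1.1 + trRatio w.1.2 + imRatio w.2) ^ 2 ≤ 8 * s * (3 * r / |A.re * A.imI|) ^ 2 := by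
    have := pow_le_pow_left₀ hR0 hR 2
    nlinarith
  rw [Set.mem_sdiff] at hshell ⊢
  exact ⟨limSigma_mono (by linarith) A hshell.1, fun h => hshell.2 (limSigma_mono (by linarith) A h)⟩

end Summit.QuantumFields.YangMills.Theorems.SwapVirialDeficit.ZeroModeSigma

end
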